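import Summits.NavierStokesRegularity.NavierStokesRegularity.Theorems.FilamentSkeletonRssKelvinGateTools

/-!
# Route `FilamentSkeletonRss` · crux `TransverseReductionRJ` (stmt-NavierStokesRegularity-21221) — line `kelvin_gate`,
# stubs S2/S3: the X·X → Y TAMENESS of the convective remainder `DW[W′]`

Helper file (theorems only, `--supports stmt-NavierStokesRegularity-21221 --as helper`), in the vocabulary of
`FilamentSkeletonRssKelvinGateDefs`.  HONEST FRAMING: bookkeeping for a HYPOTHETICAL filament-type RSS blow-up route;
nothing here bears on Navier–Stokes regularity; no stub is proved here.

The line's two scales are designed so that the Kelvin gate (stub S2) maps the forcing scale Y (weighted `C¹`,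
decay `⟨y⟩⁻²`) to the velocity scale X (weighted `C²`, decay `⟨y⟩⁻¹`) and the quadratic remainder of the profile
operator maps X × X back into Y — this file certifies the second half, the "two-line calculus fact" the line card
folded into stub S3 (formerly a separate `BilinearTame` stub):

* `XBound.yBound_fderiv_apply` — `XBound W R → XBound W′ R′ → YBound (y ↦ DW(y)[W′(y)]) (2 R R′)`:
  `⟨y⟩²|DW[W′]| ≤ (⟨y⟩|DW|)(⟨y⟩|W′|) ≤ R R′` and
  `⟨y⟩²|D(DW[W′])| ≤ ⟨y⟩²(|D²W| |W′| + |DW| |DW′|) ≤ 2 R R′`.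
Together with `lerayOp_add_eq` (`E(U⁰+W) = E(U⁰) + 𝓛W + DW[W]`) this is exactly what makes the fixed-point map
`W ↦ 𝓚_p(−r_p − DW[W])` of stub S3 act on X-balls, given a gate `𝓚_p : Y → X` from stub S2.
-/

set_option linter.dupNamespace false

noncomputable section

namespace Summit.NavierStokesRegularity.NavierStokesRegularity.Theorems.KelvinGate

open Set Function
open Literature.Analysis.FluidPDE
open scoped InnerProductSpace Laplacian ContDiff Topology

/-- **X · X → Y tameness of the convective remainder.**  If `W` is X-bounded by `R` and `W′` by `R′`, then the field
`y ↦ DW(y)[W′(y)]` is Y-bounded by `2 R R′`.  (In particular `DW[W] ∈ Y` with radius `2R²` for `W ∈ X`, the remainder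
in `lerayOp_add_eq`.) -/
theorem XBound.yBound_fderiv_apply {W W' : EuclideanSpace ℝ (Fin 3) → EuclideanSpace ℝ (Fin 3)} {R R' : ℝ}
    (hW : XBound W R) (hW' : XBound W' R') : YBound (fun y => fderiv ℝ W y (W' y)) (2 * R * R') := by
  have hR : 0 ≤ R := hW.nonneg
  have hR' : 0 ≤ R' := hW'.nonneg
  have hDWc : ContDiff ℝ 1 (fderiv ℝ W) := hW.1.fderiv_right (by norm_num)
  refine ⟨hDWc.clm_apply (hW'.1.of_le (by norm_num)), fun y => ⟨?_, ?_⟩⟩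
  · -- `⟨y⟩² |DW[W′]| ≤ (⟨y⟩|DW|)(⟨y⟩|W′|) ≤ R R′ ≤ 2 R R′`
    have h1 : (1 + ‖y‖) * ‖fderiv ℝ W y‖ ≤ R := (hW.2 y).2.1
    have h2 : (1 + ‖y‖) * ‖W' y‖ ≤ R' := (hW'.2 y).1
    calc (1 + ‖y‖) ^ 2 * ‖fderiv ℝ W y (W' y)‖
        ≤ (1 + ‖y‖) ^ 2 * (‖fderiv ℝ W y‖ * ‖W' y‖) :=
          mul_le_mul_of_nonneg_left (ContinuousLinearMap.le_opNorm _ _) (by positivity)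
      _ = ((1 + ‖y‖) * ‖fderiv ℝ W y‖) * ((1 + ‖y‖) * ‖W' y‖) := by ring
      _ ≤ R * R' := mul_le_mul h1 h2 (by positivity) hR
      _ ≤ 2 * R * R' := by nlinarith [mul_nonneg hR hR']
  · -- `D(DW[W′])(y) = DW(y) ∘ DW′(y) + D²W(y)[·](W′(y))`
    have hdc : DifferentiableAt ℝ (fderiv ℝ W) y := hDWc.differentiable (by norm_num) y
    have hdu : DifferentiableAt ℝ W' y := hW'.1.differentiable (by norm_num) y
    rw [fderiv_clm_apply hdc hdu]
    have h1 : (1 + ‖y‖) * ‖fderiv ℝ W y‖ ≤ R := (hW.2 y).2.1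
    have h2 : (1 + ‖y‖) * ‖fderiv ℝ W' y‖ ≤ R' := (hW'.2 y).2.1
    have h3 : (1 + ‖y‖) * ‖iteratedFDeriv ℝ 2 W y‖ ≤ R := (hW.2 y).2.2
    have h4 : (1 + ‖y‖) * ‖W' y‖ ≤ R' := (hW'.2 y).1
    have hflip : ‖(fderiv ℝ (fderiv ℝ W) y).flip (W' y)‖ ≤ ‖iteratedFDeriv ℝ 2 W y‖ * ‖W' y‖ := by
      refine ContinuousLinearMap.opNorm_le_bound _ (by positivity) fun h => ?_
      rw [ContinuousLinearMap.flip_apply]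
      -- `‖D²W(y)[h](v)‖ ≤ ‖D²W(y)‖ ‖h‖ ‖v‖` (cf. `PlanarEnergyAPriori.norm_fderiv_fderiv_apply_le`)
      have hle := (iteratedFDeriv ℝ 2 W y).le_opNorm ![h, W' y]
      rw [Fin.prod_univ_two, iteratedFDeriv_two_apply] at hle
      calc ‖fderiv ℝ (fderiv ℝ W) y h (W' y)‖ ≤ ‖iteratedFDeriv ℝ 2 W y‖ * (‖h‖ * ‖W' y‖) := by
            simpa using hle
        _ = ‖iteratedFDeriv ℝ 2 W y‖ * ‖W' y‖ * ‖h‖ := by ring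
    calc (1 + ‖y‖) ^ 2 * ‖(fderiv ℝ W y).comp (fderiv ℝ W' y) + (fderiv ℝ (fderiv ℝ W) y).flip (W' y)‖
        ≤ (1 + ‖y‖) ^ 2 * (‖fderiv ℝ W y‖ * ‖fderiv ℝ W' y‖ + ‖iteratedFDeriv ℝ 2 W y‖ * ‖W' y‖) := by
          refine mul_le_mul_of_nonneg_left ((norm_add_le _ _).trans (add_le_add ?_ hflip)) (by positivity)
          exact ContinuousLinearMap.opNorm_comp_le _ _
      _ = ((1 + ‖y‖) * ‖fderiv ℝ W y‖) * ((1 + ‖y‖) * ‖fderiv ℝ W' y‖) +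
            ((1 + ‖y‖) * ‖iteratedFDeriv ℝ 2 W y‖) * ((1 + ‖y‖) * ‖W' y‖) := by ring
      _ ≤ R * R' + R * R' := add_le_add (mul_le_mul h1 h2 (by positivity) hR) (mul_le_mul h3 h4 (by positivity) hR)
      _ = 2 * R * R' := by ring

end Summit.NavierStokesRegularity.NavierStokesRegularity.Theorems.KelvinGate
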